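import Mathlib
import HarnessLib

/-!
# The modified Bessel kernel ∫₀^∞ μ^{ν−1}e^{−A/μ−μt²}dμ: cosh substitution and Laplace structure

Topic `Literature/Analysis/SpecialFunctions`. Everything here is PROVED (no named facts, no
definitions); the Bessel function `K_ν` itself never appears.

For `A, t > 0` and real `ν` the "Schwinger-parametrised" kernel
`∫₀^∞ μ^{ν−1} e^{−A/μ − μt²} dμ` (the `μ`-integral produced by `|x|^{-2s} = Γ(s)⁻¹ ∫₀^∞ μ^{s−1}
e^{−μ|x|²} dμ` followed by a Gaussian Fourier transform in some of the variables) becomes, after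
the substitution `μ = (√A/t)·e^{w}` (`w ∈ ℝ`),

  `∫₀^∞ μ^{ν−1} e^{−A/μ − μt²} dμ = (√A/t)^ν ∫_ℝ e^{νw − 2√A·t·cosh w} dw`

(`integral_rpow_mul_exp_neg_div_sub_mul_sq`); classically the right-hand integral is
`2 K_ν(2√A t)` (Watson §6.22 (7), §6.23 (8); DLMF 10.32.9–10.32.10), but we do not need this
identification. What the layer-peeling arguments use is only the STRUCTURE of
`t ↦ ∫_ℝ e^{νw − c t cosh w} dw` (`c > 0`): it is the Laplace transform `∫ e^{−λt} dm(λ)` of the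
push-forward `m` of the measure `e^{νw} dw` under `w ↦ c·cosh w`, a positive measure carried by
`[c, ∞)` which charges every interval `(α, β)` with `c ≤ α < β`
(`exists_measure_laplace_eq_integral_exp_cosh`).

## Outline

* `integral_Ioi_eq_integral_const_mul_exp_smul` — the change of variables `μ = a e^{w}`,
  `∫₀^∞ g = ∫_ℝ a e^{w} g(a e^{w}) dw` (Mathlib's `integral_image_eq_integral_abs_deriv_smul`;
  no integrability hypothesis), and the pointwise algebra giving the first display;
* `mul_sub_mul_cosh_le` — `νw − κ cosh w ≤ (|ν|+1)²/κ − |w|`, whence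
  `integrable_exp_mul_sub_mul_cosh` — `w ↦ e^{νw − κ cosh w}` is integrable for `κ > 0`;
* the measure `m = (c cosh)_* (e^{νw} dw)` via `Measure.map` / `withDensity`, `integral_map` and
  `integral_withDensity_eq_integral_toReal_smul`; non-vanishing on `(α, β)` from `Real.arcosh`
  (the preimage is a non-empty open set) and positivity of Lebesgue measure on open sets.

## References

* G. N. Watson, *A Treatise on the Theory of Bessel Functions*, 2nd ed. (1944), §6.22–6.23
  (`K_ν(z) = ∫₀^∞ e^{−z cosh w} cosh νw dw`, and (8) of §6.23). [folklore]
* NIST Digital Library of Mathematical Functions, 10.32.9–10.32.10. [folklore]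
-/

noncomputable section

open _root_.MeasureTheory _root_.Real _root_.Set _root_.Filter
open scoped ENNReal

namespace Literature.Analysis.SpecialFunctions

/-! ## The substitution `μ = a e^{w}` -/

/-- `w ↦ a e^{w}` maps `ℝ` onto `(0, ∞)` for `a > 0`. [folklore] -/
theorem image_const_mul_exp_univ {a : ℝ} (ha : 0 < a) :
    (fun w : ℝ => a * Real.exp w) '' univ = Ioi 0 := by
  rw [image_univ, show (fun w : ℝ => a * Real.exp w) = (a * ·) ∘ Real.exp from rfl,
    Set.range_comp, Real.range_exp, image_const_mul_Ioi_zero ha]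

/-- **Change of variables `μ = a e^{w}`** (`a > 0`): for any `g`,
`∫₀^∞ g(μ) dμ = ∫_ℝ a e^{w} g(a e^{w}) dw`, with no integrability hypothesis (both sides vanish
together when `g` is not integrable). Mathlib's one-dimensional change-of-variables formula
`integral_image_eq_integral_abs_deriv_smul` for the injective smooth map `w ↦ a e^{w}` of `ℝ`
onto `(0, ∞)`. [folklore] -/
theorem integral_Ioi_eq_integral_const_mul_exp_smul {E : Type*} [NormedAddCommGroup E]
    [NormedSpace ℝ E] {a : ℝ} (ha : 0 < a) (g : ℝ → E) :
    ∫ μ in Ioi 0, g μ = ∫ w : ℝ, (a * Real.exp w) • g (a * Real.exp w) := by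
  have hderiv : ∀ w ∈ (univ : Set ℝ),
      HasDerivWithinAt (fun w : ℝ => a * Real.exp w) (a * Real.exp w) univ w :=
    fun w _ => ((Real.hasDerivAt_exp w).const_mul a).hasDerivWithinAt
  have hinj : InjOn (fun w : ℝ => a * Real.exp w) univ :=
    fun x _ y _ hxy => Real.exp_injective (mul_left_cancel₀ ha.ne' hxy)
  rw [← image_const_mul_exp_univ ha,
    integral_image_eq_integral_abs_deriv_smul MeasurableSet.univ hderiv hinj, Measure.restrict_univ]
  refine integral_congr_ae (ae_of_all _ fun w => ?_)
  dsimp only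
  rw [abs_of_pos (mul_pos ha (Real.exp_pos w))]

/-- **The cosh substitution in the Schwinger-parametrised layer kernel.** For `A, t > 0` and
real `ν`,

  `∫₀^∞ μ^{ν−1} e^{−A/μ − μ t²} dμ = (√A/t)^ν · ∫_ℝ e^{ν w − 2 √A t cosh w} dw`,

by the substitution `μ = (√A/t) e^{w}`: then `μ^{ν−1} dμ = (√A/t)^ν e^{νw} dw`,
`A/μ = √A t e^{−w}`, `μ t² = √A t e^{w}`, and `e^{w} + e^{−w} = 2 cosh w`. (The right-hand
integral is `2 K_ν(2√A t)`, Watson §6.23 (8) / DLMF 10.32.10, which is not used here.)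
[folklore] -/
theorem integral_rpow_mul_exp_neg_div_sub_mul_sq {A t : ℝ} (hA : 0 < A) (ht : 0 < t) (ν : ℝ) :
    ∫ μ in Set.Ioi (0 : ℝ), μ ^ (ν - 1) * Real.exp (-(A / μ) - μ * t ^ 2) =
      (Real.sqrt A / t) ^ ν * ∫ w : ℝ, Real.exp (ν * w - 2 * Real.sqrt A * t * Real.cosh w) := by
  obtain ⟨r, hr, rfl⟩ : ∃ r : ℝ, 0 < r ∧ A = r ^ 2 :=
    ⟨Real.sqrt A, Real.sqrt_pos.2 hA, (Real.sq_sqrt hA.le).symm⟩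
  rw [Real.sqrt_sq hr.le]
  have ha : 0 < r / t := div_pos hr ht
  rw [integral_Ioi_eq_integral_const_mul_exp_smul ha, ← integral_const_mul]
  refine integral_congr_ae (ae_of_all _ fun w => ?_)
  dsimp only
  have hx : 0 < r / t * Real.exp w := mul_pos ha (Real.exp_pos w)
  have h1 : r / t * Real.exp w * (r / t * Real.exp w) ^ (ν - 1) = (r / t * Real.exp w) ^ ν := by
    have h := Real.rpow_add hx 1 (ν - 1)
    rw [Real.rpow_one, show (1 : ℝ) + (ν - 1) = ν by ring] at h
    exact h.symm
  rw [smul_eq_mul, ← mul_assoc, h1, Real.mul_rpow ha.le (Real.exp_pos w).le, ← Real.exp_mul,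
    mul_assoc, ← Real.exp_add]
  congr 2
  rw [Real.cosh_eq, Real.exp_neg]
  field_simp
  ring

/-! ## Integrability of `w ↦ e^{νw − κ cosh w}` -/

/-- The elementary bound behind the integrability of `e^{νw − κ cosh w}` (`κ > 0`):
`ν w − κ cosh w ≤ (|ν| + 1)²/κ − |w|`. Indeed `κ cosh w ≥ (κ/2) e^{|w|} ≥ (κ/4) w²` and
`(|ν|+1)|w| ≤ (κ/4) w² + (|ν|+1)²/κ`. [folklore] -/
theorem mul_sub_mul_cosh_le (ν : ℝ) {κ : ℝ} (hκ : 0 < κ) (w : ℝ) :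
    ν * w - κ * Real.cosh w ≤ (|ν| + 1) ^ 2 / κ - |w| := by
  have hs : 0 ≤ |w| := abs_nonneg w
  have h1 : ν * w ≤ |ν| * |w| := by rw [← abs_mul]; exact le_abs_self _
  have h2 : Real.exp |w| ≤ 2 * Real.cosh w := by
    rw [← Real.cosh_abs, Real.cosh_eq]
    have := Real.exp_pos (-|w|)
    linarith
  have h3 : 1 + |w| + |w| ^ 2 / 2 ≤ Real.exp |w| := Real.quadratic_le_exp_of_nonneg hs
  have h4 : (|ν| + 1) * |w| ≤ κ / 4 * |w| ^ 2 + (|ν| + 1) ^ 2 / κ := by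
    rw [show κ / 4 * |w| ^ 2 + (|ν| + 1) ^ 2 / κ = ((κ * |w|) ^ 2 / 4 + (|ν| + 1) ^ 2) / κ by
      field_simp]
    rw [le_div_iff₀ hκ]
    nlinarith [sq_nonneg (κ * |w| / 2 - (|ν| + 1))]
  have h5 : κ * (1 + |w| + |w| ^ 2 / 2) ≤ κ * (2 * Real.cosh w) :=
    mul_le_mul_of_nonneg_left (h3.trans h2) hκ.le
  have h6 : 0 ≤ κ * |w| := mul_nonneg hκ.le hs
  nlinarith [h1, h4, h5, h6, hκ.le]

/-- `w ↦ e^{−|w|}` is integrable on `ℝ`. [folklore] -/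
theorem integrable_exp_neg_abs : Integrable (fun w : ℝ => Real.exp (-|w|)) := by
  rw [← integrableOn_univ, ← Iic_union_Ioi (a := (0 : ℝ))]
  refine IntegrableOn.union ?_ ?_
  · refine (integrableOn_exp_Iic 0).congr_fun (fun x hx => ?_) measurableSet_Iic
    rw [abs_of_nonpos (mem_Iic.1 hx), neg_neg]
  · refine (integrableOn_exp_neg_Ioi 0).congr_fun (fun x hx => ?_) measurableSet_Ioi
    dsimp only
    rw [abs_of_pos (mem_Ioi.1 hx)]

/-- For `κ > 0` and real `ν`, `w ↦ e^{ν w − κ cosh w}` is integrable on `ℝ` (it is dominated by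
`e^{(|ν|+1)²/κ} e^{−|w|}`). [folklore] -/
theorem integrable_exp_mul_sub_mul_cosh (ν : ℝ) {κ : ℝ} (hκ : 0 < κ) :
    Integrable (fun w : ℝ => Real.exp (ν * w - κ * Real.cosh w)) := by
  refine ((integrable_exp_neg_abs).const_mul (Real.exp ((|ν| + 1) ^ 2 / κ))).mono' ?_ ?_
  · exact (Real.continuous_exp.comp ((continuous_const.mul continuous_id).sub
      (continuous_const.mul Real.continuous_cosh))).aestronglyMeasurable
  · refine ae_of_all _ fun w => ?_
    rw [Real.norm_eq_abs, abs_of_pos (Real.exp_pos _), ← Real.exp_add]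
    exact Real.exp_le_exp.2 (by have := mul_sub_mul_cosh_le ν hκ w; linarith)

/-! ## The Laplace structure of `t ↦ ∫ e^{νw − c t cosh w} dw` -/

/-- **`t ↦ ∫_ℝ e^{νw − c t cosh w} dw` is the Laplace transform of a positive measure on
`[c, ∞)` charging every interval there.** For `c > 0` and real `ν` there is a measure `m` on `ℝ`
(namely the push-forward of `e^{νw} dw` under `w ↦ c cosh w`) with `m((−∞, c)) = 0`,
`m((α, β)) > 0` whenever `c ≤ α < β`, and, for every `t > 0`, `λ ↦ e^{−λt}` is `m`-integrable
with `∫_ℝ e^{νw − c t cosh w} dw = ∫ e^{−λt} dm(λ)`. (With `c = z`, the even part of this is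
Watson's `K_ν(z t) = ∫₀^∞ e^{−z t cosh w} cosh νw dw`, §6.22 (5)–(7), read as a Laplace
transform in `t`; DLMF 10.32.9.) The bound variable `λ` of the brief is spelled `l` (`λ` is a
keyword). [folklore] -/
theorem exists_measure_laplace_eq_integral_exp_cosh (c ν : ℝ) (hc : 0 < c) :
    ∃ m : MeasureTheory.Measure ℝ, m (Set.Iio c) = 0 ∧
      (∀ α β : ℝ, c ≤ α → α < β → 0 < m (Set.Ioo α β)) ∧
      (∀ t : ℝ, 0 < t → MeasureTheory.Integrable (fun l : ℝ => Real.exp (-(l * t))) m ∧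
        ∫ w : ℝ, Real.exp (ν * w - c * t * Real.cosh w) = ∫ l : ℝ, Real.exp (-(l * t)) ∂m) := by
  set ρ : ℝ → ℝ≥0∞ := fun w => ENNReal.ofReal (Real.exp (ν * w)) with hρ_def
  set Φ : ℝ → ℝ := fun w => c * Real.cosh w with hΦ_def
  have hρm : Measurable ρ :=
    (Real.continuous_exp.comp (continuous_const.mul continuous_id)).measurable.ennreal_ofReal
  have hρlt : ∀ᵐ w ∂(volume : Measure ℝ), ρ w < ∞ := ae_of_all _ fun _ => ENNReal.ofReal_lt_top
  have hΦc : Continuous Φ := continuous_const.mul Real.continuous_cosh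
  have hΦm : Measurable Φ := hΦc.measurable
  refine ⟨Measure.map Φ (volume.withDensity ρ), ?_, ?_, ?_⟩
  · -- `m` lives on `[c, ∞)` since `c cosh w ≥ c`
    rw [Measure.map_apply hΦm measurableSet_Iio]
    have h0 : Φ ⁻¹' Set.Iio c = ∅ := by
      refine eq_empty_of_forall_notMem fun w hw => ?_
      have hw' : c * Real.cosh w < c := hw
      exact (not_lt.2 (le_mul_of_one_le_right hc.le (Real.one_le_cosh w))) hw'
    rw [h0, measure_empty]
  · -- `m` charges every `(α, β)`, `c ≤ α < β`: the preimage is a non-empty open set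
    intro α β hα hβ
    rw [Measure.map_apply hΦm measurableSet_Ioo, pos_iff_ne_zero, Ne,
      withDensity_apply_eq_zero' hρm.aemeasurable]
    have hsupp : {w | ρ w ≠ 0} = univ := by
      refine eq_univ_of_forall fun w => ?_
      simp only [mem_setOf_eq, hρ_def, Ne, ENNReal.ofReal_eq_zero, not_le]
      exact Real.exp_pos _
    rw [hsupp, univ_inter]
    have hopen : IsOpen (Φ ⁻¹' Set.Ioo α β) := isOpen_Ioo.preimage hΦc
    have hne : (Φ ⁻¹' Set.Ioo α β).Nonempty := by
      have hv : 1 ≤ (α + β) / 2 / c := by rw [le_div_iff₀ hc]; linarith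
      have hcv : c * ((α + β) / 2 / c) = (α + β) / 2 := by field_simp
      refine ⟨Real.arcosh ((α + β) / 2 / c), ?_⟩
      show c * Real.cosh (Real.arcosh ((α + β) / 2 / c)) ∈ Set.Ioo α β
      rw [Real.cosh_arcosh hv, hcv]
      exact ⟨by linarith, by linarith⟩
    exact hopen.measure_ne_zero volume hne
  · -- the Laplace-transform identity, by `integral_map` and `withDensity`
    intro t ht
    have hf : Continuous fun l : ℝ => Real.exp (-(l * t)) :=
      Real.continuous_exp.comp (continuous_id.mul continuous_const).neg
    have hpt : ∀ w : ℝ,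
        (ρ w).toReal • Real.exp (-(Φ w * t)) = Real.exp (ν * w - c * t * Real.cosh w) := by
      intro w
      simp only [hρ_def, hΦ_def, ENNReal.toReal_ofReal (Real.exp_pos _).le, smul_eq_mul]
      rw [← Real.exp_add]
      congr 1
      ring
    refine ⟨?_, ?_⟩
    · rw [integrable_map_measure hf.aestronglyMeasurable hΦm.aemeasurable,
        integrable_withDensity_iff_integrable_smul' hρm hρlt]
      refine (integrable_exp_mul_sub_mul_cosh ν (mul_pos hc ht)).congr (ae_of_all _ fun w => ?_)
      simp only [Function.comp_apply]
      exact (hpt w).symm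
    · rw [integral_map hΦm.aemeasurable hf.aestronglyMeasurable,
        integral_withDensity_eq_integral_toReal_smul hρm hρlt]
      exact integral_congr_ae (ae_of_all _ fun w => (hpt w).symm)

end Literature.Analysis.SpecialFunctions
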